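/-
Copyright (c) 2026 the pub-hodgecm-mathlib formalisation cell (harness21).  Prover seat hodgecm-mathlib-LH4-p15 (g0), req620 Track A «(D-RAM) FOUR-FRAME» squad
(STAGE-1b, row (2) of the piece `f_{T₊}`, the (β₂) road (R-36) «PURE-CELL LEDGER»: β₂ sub-dealer LH4-p04 (g8) coverage check (2) 16:09:32Z, rows (L-T)∕(ρ-c) (LH7-p10∕LH7-p09∕LH4-p09),
(L-P); frame ★ p861810 (LH4-p16 (g0)), exact size ★ p862037 (this seat), ★ p861224 (LH4-p07)), 2026-09-04.
-/
import Summits.HodgeConjecture.HodgeConjecture.Theorems.F0P3cDyRamBoundaryCellLetterCardTwo   -- ★ p862037 (this seat): §1 transport, §2 `v_trace_div_sub_main_eq`; brings ★ p861810's frame, ★ p861653, ★ p861372 HEAD B, ★ p861224 `v_add_lt_one_of_v_eq_one_of_card_two`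
import HarnessLib

/-!
# Crux `H413`, line LH4 «(D-RAM) FOUR-FRAME» — the (β₂) road (R-36) «PURE-CELL LEDGER»: «THE TERMINAL CELL IS UNLABELLED (q = 2, d even)» — at `δ = c` (the depth multiplier's
# anti-invariant part has EXACTLY the size of the cell's scale) the ray scalar of a ray-dominated glued vertex is a NON-unit, so its `ϖ^m`-value set is NEITHER label class:
# the tower column at the hyperbolic literal is covered by CLEAN (★ p861810) ∕ BOUNDARY (★ p862037) ∕ TERMINAL (this file) ∕ EMPTY (LH7-p10's atlas)

Cell `hodgecm-mathlib` (D-0151), FLOOR 0, crux item H413 = `stmt-HodgeConjecture-24833`, route of record `HCCMUnconditional`; squad F0∕P3c∕LH4; lane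
`--supports stmt-HodgeConjecture-24833 --as helper` (count-neutral; pays NO tier-0 row).  THEOREMS ONLY (no `def`, no instance, no notation, no `sorry`, default heartbeats);
★-only imports; states NO law; (β₂) stays a HYPOTHESIS.  DATUM-FREE: plane field `E` (ramified datum `(σ, ϖ, d, t_E)`, `|2| < 1`, `#𝓀[E] = 2`, `d` even), line model `M`.

WHY (LH4-p04 (g8) 16:09:32Z COVERAGE CHECK (2): «(L-Σ) needs a ZERO or a VALUE for EVERY cell»; heir LEAD T20-19 (ρ-c); this seat's model `work/model/tower_experiment.py`
16:38:53Z: at the HYP literal the cell `c = δ` is POPULATED and 8∕8 (δ = 4), 16∕16 (δ = 6) of its value sets lie in NEITHER class).  Three regimes exhaust the tower column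
at even `d = 2`: CLEAN `δ − c ≥ m*` (★ p861810: D's letter `(f·h_W) • X₊`), BOUNDARY `δ − c = m* − 1` (★ p862037: the c-twist), TERMINAL `δ = c`.  At `δ = c` the exact-size
lemma ★ p862037 `v_trace_div_sub_main_eq` read at exponent `n = 0` says the correction `τ` (`jE τ = Tr_ρ(θ∕D₀)`) is a UNIT like the main term `f·h_W·t₊·N(ϖ^b g₁)`; with a
two-element residue field two units never sum to a unit (★ p861224), so the ray scalar `e₀` (`jE e₀ = Tr_ρ(μ∕D₀)`, ★ p861653) has `|e₀| < 1`, and a value set `VS_m(g • X₊)`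
with `|g| < 1` contains NO unit value whereas every label class `VS_m(e • X₊)` (`|e| = 1`, `d` even) contains the unit `e·t₊`:
* §1 (T1) `valueSetMod_smul_xPlus_ne_of_v_lt_one` — `|g| < 1`, `|e| = 1`, `1 ≤ m`, `d` even ⇒ `valueSetMod σ ϖ m (g • X₊) ≠ valueSetMod σ ϖ m (e • X₊)`.
* §2 (T2) HEAD `valueSet_endoGL_sub_one_glued_ne_smul_xPlus_of_terminal` — ★ p862037's HEAD frame (★ p861810 letters + `hD h2v hq hd2`, `|h_W| = 1`, `|f| = 1`, any level
  `1 ≤ m ≤ m′, 2b` with `|u₀₀ − 1| ≤ |ϖ^m|`) with the TERMINAL letters `hlam⁰ : |μ + jE(f·t₊·(ϖσϖ)^b)| ≤ |D₀|`, `hjl⁰ : |μ − ρμ| = |D₀|`, `hgap : |D₀| < |jEϖ|^{2b}` ⇒ for EVERY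
  unit `e` the `ϖ^m`-value set of `Γ − 1` on `L` is `≠ valueSetMod σ ϖ m (e • X₊)` — in particular neither `V₊` nor `V₋`: the cell pays `0` to a labelled difference.
HONEST LABEL.  Count-neutral value-set algebra; nothing printed is asserted; no census law is stated; how LH4-p04's `Q₊∕Q₋` shell conjuncts treat an unlabelled vertex is the
(L-Σ)∕(L-P) assembly's business; `HC_CM` is proved only modulo the 7 printed citations (2 remaining named inputs: hLiu418 = `stmt-HodgeConjecture-24832`, h413 =
`stmt-HodgeConjecture-24833`) until rung 0 closes.
## References
* [Jacobowitz1962] R. Jacobowitz, *Hermitian forms over local fields*, Amer. J. Math. 84 (1962): §4.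
* [Serre1979] J.-P. Serre, *Local Fields*, GTM 67 (1979): Ch. I §1 (residue field); Ch. V §3 Cor. 3.
* [Rogawski1990] J. D. Rogawski, *Automorphic Representations of Unitary Groups in Three Variables*, Ann. of Math. Stud. 123 (1990): §4.9 Prop. 4.9.1 (b) p. 55.
* [Kottwitz1986BaseChangeUnits] R. E. Kottwitz, *Base change for unit elements of Hecke algebras*, Compositio Math. 60 (1986): §1 pp. 240–241.
-/

set_option autoImplicit false

noncomputable section

namespace Summit.HodgeConjecture.HodgeConjecture.Cruxes.H413.F0P3cDyRamTerminalCellUnlabelledCardTwo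

open scoped Valued WithZero Matrix MatrixGroups
open WithZero
open Literature.NumberTheory.Automorphic Literature.NumberTheory.Automorphic.HermitianLattice Literature.NumberTheory.Automorphic.UnitaryLatticeTree
open Literature.NumberTheory.Automorphic.UnitaryThreeFourFrame (IsRamifiedQuadraticDatum)
open Literature.NumberTheory.LocalFields Literature.NumberTheory.LocalFields.WildQuadraticDatum
open Literature.NumberTheory.Rogawski1990
open Summit.HodgeConjecture.HodgeConjecture.Cruxes.H413.F0P3cDyRamToricCensusDefs
open Summit.HodgeConjecture.HodgeConjecture.Cruxes.H413.F0P3cDyRamFourFramePieces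
open Summit.HodgeConjecture.HodgeConjecture.Cruxes.H413.F0P3cDyRamDepthFormLineModel
open Summit.HodgeConjecture.HodgeConjecture.Cruxes.H413.F0P3cDyRamNormFormRayDominated (normFormSet_eq_ray_of_isOrd)
open Summit.HodgeConjecture.HodgeConjecture.Cruxes.H413.F0P3cDyRamDiagonalCellLetter (inv_add_map_inv_eq_map_pairing)
open Summit.HodgeConjecture.HodgeConjecture.Cruxes.H413.F0P3cDyRamBlockGlueLabelFibreConstant (pairing_self_eq_plane_add_line)
open Summit.HodgeConjecture.HodgeConjecture.Cruxes.H413.F0P3cDyRamRayDominatedCellLetter (v_map_le_map_pow_of_le)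
open Summit.HodgeConjecture.HodgeConjecture.Cruxes.H413.F0P3cDyRamSmulXPlusLabel (valueSetMod_smul_xPlus)
open Summit.HodgeConjecture.HodgeConjecture.Cruxes.H413.F0P3cDyRamCoreHangingEmptyOfCardTwo (v_add_lt_one_of_v_eq_one_of_card_two)
open Summit.HodgeConjecture.HodgeConjecture.Cruxes.H413.F0P3cDyRamBoundaryCellLetterCardTwo

variable {E M : Type} [Field E] [Valued E ℤᵐ⁰] [Field M] [Valued M ℤᵐ⁰] {ρ Θ : M →+* M} {α : M}

/-! ## §1 (T1) A value set along a non-unit scalar is neither label class -/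

omit [Field M] [Valued M ℤᵐ⁰] in
/-- **(T1) «A NON-UNIT RAY IS UNLABELLED»**: `σ` isometric, `|ϖ| = exp(−1)`, `|ϖ − σϖ| = |ϖ|^d` with `d` even (so `|t₊| = 1`), `1 ≤ m`: if `|g| < 1` and `|e| = 1` then
`valueSetMod σ ϖ m (g • X₊) ≠ valueSetMod σ ϖ m (e • X₊)` — the class of `e` contains the unit value `e·t₊`, every value of the class of `g` is `ϖ^m`-close to a non-unit.
[cite: Serre1979, Ch. I §1] [cite: Rogawski1990, §4.9 Prop. 4.9.1 (b) p. 55] -/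
theorem valueSetMod_smul_xPlus_ne_of_v_lt_one {σ : E →+* E} (hvσ : ∀ a, Valued.v (σ a) = Valued.v a) {ϖ : E} (hϖ : Valued.v ϖ = exp (-1 : ℤ)) {d : ℕ}
    (hd : Valued.v (ϖ - σ ϖ) = Valued.v ϖ ^ d) (hd2 : d % 2 = 0) {m : ℕ} (hm1 : 1 ≤ m) {g e : E} (hg : Valued.v g < 1) (he1 : Valued.v e = 1) :
    valueSetMod σ ϖ m (g • xPlus σ ϖ d) ≠ valueSetMod σ ϖ m (e • xPlus σ ϖ d) := by
  have hvϖ0 : Valued.v ϖ ≠ 0 := by rw [hϖ]; exact WithZero.exp_ne_zero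
  have hϖlt : Valued.v ϖ < 1 := by rw [hϖ, ← WithZero.exp_zero, WithZero.exp_lt_exp]; norm_num
  set t : E := (ϖ - σ ϖ) * ((ϖ * σ ϖ) ^ ((d - d % 2) / 2))⁻¹ with htdef
  have ht1 : Valued.v t = 1 := by
    have hdd' : 2 * ((d - d % 2) / 2) = d := by omega
    rw [htdef, Valuation.map_mul, map_inv₀, hd, Valuation.map_pow, Valuation.map_mul, hvσ, ← pow_two, ← pow_mul, hdd',
      mul_inv_cancel₀ (pow_ne_zero _ hvϖ0)]
  intro hEq
  -- the unit value `e·t` of the class of `e`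
  have hmem : e * t ∈ valueSetMod σ ϖ m (e • xPlus σ ϖ d) := by
    rw [valueSetMod_smul_xPlus]
    refine ⟨1, by rw [Valuation.map_one], ?_⟩
    rw [map_one, ← htdef, mul_one, mul_one, sub_self, mul_zero, Valuation.map_zero]
    exact zero_le
  rw [← hEq, valueSetMod_smul_xPlus] at hmem
  obtain ⟨a, ha, hz⟩ := hmem
  rw [← htdef] at hz
  -- `|e t − g·t·N(a)| ≤ |ϖ|^m < 1`, but `|e t| = 1 > |g·t·N(a)|`
  have hpm : Valued.v (ϖ ^ m) ≠ 0 := (Valuation.ne_zero_iff _).2 (pow_ne_zero _ (fun h0 => hvϖ0 (by rw [h0, map_zero])))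
  have hle : Valued.v (e * t - g * (t * (a * σ a))) ≤ Valued.v (ϖ ^ m) := by
    rw [Valuation.map_mul, map_inv₀] at hz
    rwa [inv_mul_le_iff₀ (zero_lt_iff.2 hpm), mul_one] at hz
  have hlt1 : Valued.v (ϖ ^ m) < 1 := by rw [Valuation.map_pow]; exact pow_lt_one₀ zero_le hϖlt (by omega)
  have h1 : Valued.v (g * (t * (a * σ a))) = Valued.v g * (Valued.v a * Valued.v a) := by
    rw [Valuation.map_mul, Valuation.map_mul, ht1, one_mul, Valuation.map_mul, hvσ]
  have h2 : Valued.v (e * t) = 1 := by rw [Valuation.map_mul, he1, ht1, one_mul]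
  have hsmall : Valued.v (g * (t * (a * σ a))) < Valued.v (e * t) := by
    rw [h1, h2]
    calc Valued.v g * (Valued.v a * Valued.v a) ≤ Valued.v g * (1 * 1) := by gcongr
      _ = Valued.v g := by rw [mul_one, mul_one]
      _ < 1 := hg
  have hexact : Valued.v (e * t - g * (t * (a * σ a))) = Valued.v (e * t) := by
    rw [sub_eq_add_neg, Valuation.map_add_eq_of_lt_left _ (by rw [Valuation.map_neg]; exact hsmall)]
  rw [hexact, h2] at hle
  exact absurd (lt_of_le_of_lt hle hlt1) (lt_irrefl 1)

/-! ## §2 (T2) HEAD — at `δ = c` the glued vertex is unlabelled -/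

/-- **(T2) HEAD — «THE TERMINAL CELL IS UNLABELLED».**  Frame of ★ p862037's HEAD (★ p861810's letters: HEAD B frame, `ρ`∕`Θ`∕order letters, ray domination `hYO hμ hμt hmm`,
`m ≤ 2b`; the wild `q = 2` frame `hD`, `|2| < 1`, `#𝓀[E] = 2`, `d` even; `|h_W| = 1`, `|f| = 1`) at ANY level `1 ≤ m` (`|u₀₀ − 1| ≤ |ϖ^m|`), with the TERMINAL letters
`hlam⁰ : |μ + jE(f·t₊·(ϖσϖ)^b)| ≤ |D₀|`, `hjl⁰ : |μ − ρμ| = |D₀|` (`δ = c` EXACTLY), `hgap : |D₀| < |jEϖ|^{2b}` (`μ = lam − jE u₀₀`, `D₀ = cc(α − ρα)·ΘY`).  THEN for EVERY unit `e`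
the `ϖ^m`-value set of `Γ − 1` on `L` is `≠ valueSetMod σ ϖ m (e • xPlus σ ϖ d)`: ★ HEAD B → ★ p861653 ray letter `(e₀·t₊⁻¹) • X₊` → ★ p862037 §2 at `n = 0` (`|e₀ − main| = 1 =
|main|`) → ★ p861224 (`|e₀| < 1` at `q = 2`) → (T1). [cite: Jacobowitz1962, §4] [cite: Rogawski1990, §4.9 Prop. 4.9.1 (b) p. 55] [cite: Kottwitz1986BaseChangeUnits, §1 pp. 240–241]
[cite: Serre1979, Ch. I §1] -/
theorem valueSet_endoGL_sub_one_glued_ne_smul_xPlus_of_terminal [CompleteSpace E] [Fintype 𝓀[E]]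
    {σ : E →+* E} {ϖ : E} {d tE : ℕ} (hD : IsRamifiedQuadraticDatum σ ϖ d tE) (h2v : Valued.v (2 : E) < 1) (hq : Fintype.card 𝓀[E] = 2) (hd2 : d % 2 = 0)
    (H₂ : Matrix (Fin 2) (Fin 2) E) {h : E} (hh1 : Valued.v h = 1)
    (jE : E →+* M) (hjv : ∀ c, Valued.v (jE c) ≤ 1 ↔ Valued.v c ≤ 1) (hjfix : ∀ z, ρ z = z ↔ ∃ c, jE c = z)
    (hρρ : ∀ x, ρ (ρ x) = x) (hvρ : ∀ x, Valued.v (ρ x) = Valued.v x) (hα : ρ α ≠ α) (hα1 : Valued.v α ≤ 1)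
    (hintρ : ∀ z : M, Valued.v z ≤ 1 → Valued.v ((z - ρ z) / (α - ρ α)) ≤ 1)
    (hΘΘ : ∀ x, Θ (Θ x) = x) (hΘρ : ∀ x, Θ (ρ x) = ρ (Θ x)) (hvΘ : ∀ x, Valued.v (Θ x) = Valued.v x) (hΘj : ∀ c, Θ (jE c) = jE (σ c))
    (φ : (Fin 2 → E) →+ M) (hφs : ∀ (c : E) (x : Fin 2 → E), φ (c • x) = jE c * φ x)
    {γ₂ : GL (Fin 2) E} {lam hM : M} (hφγ : ∀ x, φ ((γ₂ : Matrix (Fin 2) (Fin 2) E) *ᵥ x) = lam * φ x) (hhM : hM ≠ 0) (hΘh : Θ hM = hM)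
    (hform : ∀ x y, jE (pairing σ H₂ x y) = hM * Θ (φ x) * φ y + ρ (hM * Θ (φ x) * φ y))
    {L : Submodule 𝒪[E] (Fin 3 → E)} {b : ℕ} (hpr : ∀ x ∈ L, Valued.v (x 1) * Valued.v ϖ ^ b ≤ 1)
    (hint : ∀ y ∈ L, Valued.v (pairing σ (!![H₂ 0 0, 0, H₂ 0 1; 0, h, 0; H₂ 1 0, 0, H₂ 1 1] : Matrix (Fin 3) (Fin 3) E) y y) ≤ 1)
    {B₂ : Submodule 𝒪[E] (Fin 2 → E)} {w₀ : Fin 2 → E} {g₀ : Fin 3 → E}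
    (hB : B₂.map ((Matrix.toLin' (!![1, 0; 0, 0; 0, 1] : Matrix (Fin 3) (Fin 2) E)).restrictScalars 𝒪[E]) =
      L ⊓ LinearMap.ker ((LinearMap.proj (1 : Fin 3) : (Fin 3 → E) →ₗ[E] E).restrictScalars 𝒪[E]))
    (hg₀ : g₀ ∈ L) (hg₀1 : Valued.v (g₀ 1) * Valued.v ϖ ^ b = 1) (hprg : g₀ - Pi.single 1 (g₀ 1) = ![w₀ 0, 0, w₀ 1])
    (u : GL (Fin 1) E) {m : ℕ} (hm1 : 1 ≤ m) (hum : Valued.v ((u : Matrix (Fin 1) (Fin 1) E) 0 0 - 1) ≤ Valued.v (ϖ ^ m))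
    {cc x₀ : M} (hc : ρ cc = cc) (hc0 : cc ≠ 0) (hc1 : Valued.v cc ≤ 1) (hcc : cc * (α - ρ α) ≠ 0) (hx₀ : x₀ ≠ 0)
    {Λ : AddSubgroup M} (hBΛ : B₂.toAddSubgroup.map φ = Λ)
    (hΛx : ∀ x, x ∈ Λ ↔ ∃ ζ, IsOrd ρ α cc ζ ∧ x = x₀ * ζ) (hw₀Y : φ w₀ = (dualGen ρ Θ α cc hM x₀)⁻¹ * x₀)
    (hYO : IsOrd ρ α cc (dualGen ρ Θ α cc hM x₀))
    {μt : M} {m' : ℕ} (hμ : lam - jE ((u : Matrix (Fin 1) (Fin 1) E) 0 0) = jE (ϖ ^ m') * μt) (hμt : IsOrd ρ α cc μt)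
    (hmm : m ≤ m') (hmb : m ≤ 2 * b) {f : E} (hf1 : Valued.v f = 1)
    (hlam0 : Valued.v (lam - jE ((u : Matrix (Fin 1) (Fin 1) E) 0 0) + jE (f * ((ϖ - σ ϖ) * ((ϖ * σ ϖ) ^ ((d - d % 2) / 2))⁻¹) * (ϖ * σ ϖ) ^ b)) ≤
      Valued.v (cc * (α - ρ α) * Θ (dualGen ρ Θ α cc hM x₀)))
    (hjl0 : Valued.v ((lam - jE ((u : Matrix (Fin 1) (Fin 1) E) 0 0)) - ρ (lam - jE ((u : Matrix (Fin 1) (Fin 1) E) 0 0))) =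
      Valued.v (cc * (α - ρ α) * Θ (dualGen ρ Θ α cc hM x₀)))
    (hgap : Valued.v (cc * (α - ρ α) * Θ (dualGen ρ Θ α cc hM x₀)) < Valued.v (jE ϖ) ^ (2 * b))
    {e : E} (he1 : Valued.v e = 1) :
    {z : E | ∃ y ∈ L, Valued.v ((ϖ ^ m)⁻¹ * (z - pairing σ (!![H₂ 0 0, 0, H₂ 0 1; 0, h, 0; H₂ 1 0, 0, H₂ 1 1] : Matrix (Fin 3) (Fin 3) E) y
        ((((endoGL (γ₂, u) : GL (Fin 3) E) : Matrix (Fin 3) (Fin 3) E) - 1) *ᵥ y))) ≤ 1} ≠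
      valueSetMod σ ϖ m (e • xPlus σ ϖ d) := by
  obtain ⟨hσσ, hvσ, hϖ, hfix, hdd, h1d, ht2⟩ := id hD
  -- names
  set Y : M := dualGen ρ Θ α cc hM x₀ with hYdef
  set D₀ : M := cc * (α - ρ α) * Θ Y with hD₀def
  set μ : M := lam - jE ((u : Matrix (Fin 1) (Fin 1) E) 0 0) with hμdef
  set t : E := (ϖ - σ ϖ) * ((ϖ * σ ϖ) ^ ((d - d % 2) / 2))⁻¹ with htdef
  have hb : 1 ≤ b := by omega
  have hvϖ0 : Valued.v ϖ ≠ 0 := by rw [hϖ]; exact WithZero.exp_ne_zero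
  have hϖ0 : ϖ ≠ 0 := fun h0 => by rw [h0, map_zero] at hvϖ0; exact hvϖ0 rfl
  have hϖlt : Valued.v ϖ < 1 := by rw [hϖ, ← WithZero.exp_zero, WithZero.exp_lt_exp]; norm_num
  have hϖ1 : Valued.v ϖ ≤ 1 := hϖlt.le
  have hρj : ∀ c : E, ρ (jE c) = jE c := fun c => (hjfix _).2 ⟨c, rfl⟩
  have hY0 : Y ≠ 0 := by
    rw [hYdef, dualGen_def]; exact mul_ne_zero (mul_ne_zero hhM (mul_ne_zero hx₀ ((map_ne_zero Θ).2 hx₀))) hcc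
  have hD₀0 : D₀ ≠ 0 := mul_ne_zero hcc ((map_ne_zero Θ).2 hY0)
  have hjϖ1 : Valued.v (jE ϖ) < 1 := (v_map_lt_one_iff_of_le_iff jE hjv ϖ).2 hϖlt
  have h2M : Valued.v (2 : M) < 1 := by
    have h := (v_map_lt_one_iff_of_le_iff jE hjv 2).2 h2v
    rwa [map_ofNat] at h
  -- `|t₊| = 1` (d even)
  have ht1 : Valued.v t = 1 := by
    have hdd' : 2 * ((d - d % 2) / 2) = d := by omega
    rw [htdef, Valuation.map_mul, map_inv₀, hdd, Valuation.map_pow, Valuation.map_mul, hvσ, ← pow_two, ← pow_mul, hdd',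
      mul_inv_cancel₀ (pow_ne_zero _ hvϖ0)]
  have ht0 : t ≠ 0 := fun h0 => by rw [h0, map_zero] at ht1; exact zero_ne_one ht1
  -- the glue letters
  have hTr : D₀⁻¹ + ρ D₀⁻¹ = jE (pairing σ H₂ w₀ w₀) := inv_add_map_inv_eq_map_pairing σ H₂ jE hΘΘ φ hhM hform hcc hx₀ hw₀Y
  have hw₀g : (![g₀ 0, g₀ 2] : Fin 2 → E) = w₀ := by
    have h0 := congrFun hprg 0
    have h2 := congrFun hprg 2
    ext i; fin_cases i
    · simpa using h0
    · simpa using h2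
  have hintg : Valued.v (pairing σ H₂ w₀ w₀ + σ (g₀ 1) * h * g₀ 1) ≤ 1 := by
    have h1 := hint g₀ hg₀
    rwa [pairing_self_eq_plane_add_line σ H₂ h g₀, hw₀g] at h1
  have hu₀ : Valued.v (ϖ ^ b * g₀ 1) = 1 := by rw [Valuation.map_mul, Valuation.map_pow, mul_comm]; exact hg₀1
  have hν : Valued.v (D₀⁻¹ + ρ D₀⁻¹) < Valued.v D₀⁻¹ := v_inv_add_map_inv_lt hvσ jE hjv hϖ0 hϖlt hD₀0 hTr hintg hb hu₀ hh1 hgap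
  have hcm : Valued.v (jE (f * t * (ϖ * σ ϖ) ^ b)) ≤ Valued.v (jE ϖ) ^ m := by
    refine v_map_le_map_pow_of_le jE hjv hϖ0 ?_
    have hϖσ : Valued.v ((ϖ * σ ϖ) ^ b) = Valued.v ϖ ^ (2 * b) := by
      rw [Valuation.map_pow, Valuation.map_mul, hvσ, ← pow_two, ← pow_mul]
    rw [Valuation.map_mul, hϖσ, Valuation.map_mul, hf1, ht1, one_mul, one_mul]
    exact pow_le_pow_right_of_le_one' hϖ1 hmb
  -- HEAD B, the ray scalar `e₀`, the ray letter
  rw [valueSet_endoGL_sub_one_glued_eq_normFormSet_of_gen σ hϖ H₂ h jE hjv hΘΘ φ hφs hφγ hhM hform hpr hint hB hg₀ hg₀1 hprg u m hum hcc hx₀ hBΛ hΛx hw₀Y]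
  have hρT : ρ (μ / D₀ + ρ (μ / D₀)) = μ / D₀ + ρ (μ / D₀) := by rw [map_add, hρρ, add_comm]
  obtain ⟨e₀, he₀⟩ := (hjfix _).1 hρT
  have hray := normFormSet_eq_ray_of_isOrd hρρ hvρ hα hα1 hintρ hΘΘ hΘρ hvΘ hc hc0 hc1 hcc hhM hΘh hx₀ hΛx hYO hvσ hϖ hdd jE hjv hΘj hjfix hμ hμt hmm he₀
  -- ★ p862037 §2 at exponent 0: the correction is a unit, like the main term
  have hX := v_trace_div_sub_main_eq σ jE hjv hρj hvρ h2M hD₀0 hTr hν hintg hϖ0 hjϖ1 (show 0 < m by omega) hcm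
    (by rw [pow_zero, one_mul]; exact hlam0) (by rw [pow_zero, one_mul]; exact hjl0)
  rw [← he₀, ← map_sub, v_map_eq_map_pow_iff jE hjv hϖ0, pow_zero] at hX
  set u₁ : E := ϖ ^ b * g₀ 1 with hu₁
  have hmain1 : Valued.v (f * h * (t * (u₁ * σ u₁))) = 1 := by
    rw [Valuation.map_mul, Valuation.map_mul, Valuation.map_mul, ht1, Valuation.map_mul, hf1, hh1, hvσ, hu₀]; simp only [mul_one]
  -- two units never sum to a unit at `q = 2`: `|e₀| < 1`
  have he₀lt : Valued.v e₀ < 1 := by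
    have h := v_add_lt_one_of_v_eq_one_of_card_two hq hmain1 hX
    rwa [add_sub_cancel] at h
  have hg : Valued.v (e₀ * t⁻¹) < 1 := by rw [Valuation.map_mul, map_inv₀, ht1, inv_one, mul_one]; exact he₀lt
  have hfin := valueSetMod_smul_xPlus_ne_of_v_lt_one hvσ hϖ hdd hd2 hm1 hg he1
  intro hEq
  apply hfin
  rw [← hray, ← hEq]
  ext z
  simp only [Set.mem_setOf_eq, mul_div_right_comm]
  exact Iff.rfl

end Summit.HodgeConjecture.HodgeConjecture.Cruxes.H413.F0P3cDyRamTerminalCellUnlabelledCardTwo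

end
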